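import Summits.FinalStateConjecture.FinalStateConjecture.Theorems.BartnikGapSettlingGapExhaustionMultiplierBelowShellUniformOf
import Summits.FinalStateConjecture.FinalStateConjecture.Theorems.BartnikGapSettlingGapExhaustionConditionalMultiplierOf
import HarnessLib

/-!
# `KerrConditionalMultiplierUniformOf`: the time-uniform `T`-conditional multiplier form,
# UNIFORMLY over a compact set of subextremal labels `ℓ = (M, a)`, FROM a label-uniform
# zero-energy exact margin
(crux `GapExhaustion`, stmt-FinalStateConjecture-10808, line photon-shell-pseudoconvexity;
stub (UU-T-of) `stub_kerrConditionalMultiplierU_of_margin`, the label-uniform twin of the per-label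
glue (P-2) `stub_kerrConditionalMultiplier_of` of
`BartnikGapSettlingGapExhaustionConditionalMultiplierOf.lean`; lead c11, label-uniformity wave 4,
S6b `T`-conditional chain)

The registered outward Killing sweep S5 quantifies its constants BEFORE the Kerr label `(M, a)`,
over a compact window of subextremal labels, so the `T`-conditional multiplier form of the
cylinders `{r = c}` beyond the horizon (the quantitative condition (po3) of Ionescu–Klainerman,
Invent. Math. 175 (2009), Definition 3.1, with the conditioning vector field `T` close to the
stationary field `∂₀`) has to hold with ONE pair `(δ, ε₁)` for all labels `ℓ = (M, a)` of a
compact `K ⊆ {0 < M, |a| < M}` and all bands `r_lo(ℓ) ≤ r ≤ r_e(ℓ)`, `r₊(ℓ) < r_lo(ℓ)`, `r_lo`,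
`r_e` continuous on `K`.

Here the exact-Kerr ZERO-ENERGY Hessian margin — `Hess r(w,w) ≤ −m‖w‖²` on the null vectors
tangent to the cylinders and `g_ℓ`-orthogonal to `∂₀`, for every label of `K`, at every band point
and every time — is taken as a HYPOTHESIS (it is supplied, uniformly in the label, by the companion
stub (UB-T)); from it and the landed PARAMETRIC passage (UP-1) `stub_multiplierFormStableParam`
from a constrained margin over a compact set of LABELLED points to the uniform, `C¹`-stable
multiplier form — stable also under a `δ`-perturbation `e ↦ e'` of the conditioning vector — we
deduce: **there are `δ, ε₁ > 0` such that for every `ℓ ∈ K`, every spacetime chart `Φ` on the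
exterior region `{ℓ.1 < r}` whose pulled-back components are `δ`-close in `C²` sup norm to `g_ℓ`
on the band of `ℓ`, and every vector field `T` that is `δ`-close to `∂₀` on the band, every band
point `z` (all times) carries a multiplier `μ`, `|μ| ≤ ε₁⁻¹`, with
`ε₁²‖w‖² ≤ μ (Φ^* g)_z(w,w) − Hess r_z(w,w) + ε₁⁻² ((Φ^* g)_z(T z, w)² + dr_z(w)²)` for all `w`.**

Proof: (UP-1) is applied on the compact labelled time slice
`S = {(ℓ, z) | ℓ ∈ K, z⁰ = 0, r_lo(ℓ) ≤ r_{ℓ.2}(z) ≤ r_e(ℓ)}`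
(`stub_kerrEscapeFieldsContinuousU_isCompact_slice`) with `G₀ ℓ = g_ℓ`, `f ℓ = r_{ℓ.2}`, the
conditioning vector `e = ∂₀` and the margin `m`; the joint smoothness of `(M, a, x) ↦ g_{M,a}(x)`
and `(a, x) ↦ r_a(x)` on `{r > 0} ⊇ S` is `Kerr.contDiffAt_bilin₃`, `Kerr.contDiffAt_radius₂`.
The per-point part is that of the per-label glue verbatim with `(M, a) := (ℓ.1, ℓ.2)`: pointwise
`C¹`-closeness from the `C²` sup norm (`enorm_iteratedFDeriv_le_supCkENorm`), translation of a band
point `z` at time `t = z⁰` to the slice (`z = z' + t ∂₀`) by the stationarity of Kerr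
(`Kerr.bilin_add_smul_basisVector_zero`, `Kerr.radius_add_time_smul_basisVector`), the perturbed
conditioning vector `e' := T z` taken AT the band point (the stability lemma is pointwise in `e'`),
and the naturality of the coordinate Hessian under translations
(`kerrCylindersBendInward_hessAt_comp_add_right`, `fderiv_comp_add_right`).

References: A. D. Ionescu, S. Klainerman, Invent. Math. 175 (2009), Definition 3.1; JAMS 26 (2013),
Lemma 2.11 [IonescuKlainerman2013]; R. P. Kerr, A. Schild (1965), §§2–3 [KerrSchild1965].
-/

noncomputable section

-- instance search through the nested operator types `E4 →L[ℝ] E4 →L[ℝ] E4 →L[ℝ] ℝ`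
set_option maxSynthPendingDepth 3

-- D-0017: single-problem summit, `Summit.<S>.<S>.…` by design (cf. lakefile `weak.linter.dupNamespace`).
set_option linter.dupNamespace false

namespace Summit.FinalStateConjecture.FinalStateConjecture.Theorems

open Set Literature.Geometry.Lorentzian Literature.Geometry.Lorentzian.MetricCoord
open scoped Manifold ContDiff Topology ENNReal

/-- **(UU-T-of) The time-uniform `T`-conditional multiplier form (Ionescu–Klainerman,
Invent. Math. 175 (2009), Definition 3.1 (po3); JAMS 26 (2013), Lemma 2.11) on the Kerr bands
beyond the horizon, uniformly over a compact set `K` of subextremal labels, from a label-uniform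
zero-energy exact margin.** Given the exact-Kerr Hessian margin `−m` on the null vectors tangent
to the cylinders and `g_ℓ`-orthogonal to `∂₀`, on the bands `r₊(ℓ) < r_lo(ℓ) ≤ r ≤ r_e(ℓ)`,
`ℓ ∈ K` (hypothesis), the parametric, `C¹`-stable passage from a constrained Hessian margin over
a compact set of labelled points to the uniform multiplier form (`stub_multiplierFormStableParam`,
conditioning vector `e = ∂₀`), applied on the compact labelled time slice
`{(ℓ, x) | ℓ ∈ K, x⁰ = 0, r_lo(ℓ) ≤ r ≤ r_e(ℓ)}` with `G₀ ℓ = g_ℓ`, `f ℓ = r_{ℓ.2}`, gives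
`δ, ε₁ > 0` such that: for every `ℓ ∈ K`, every spacetime chart `Φ` on the exterior region
`{ℓ.1 < r}` whose pulled-back components are `δ`-close to `g_ℓ` in `C²` sup norm on the band,
and every vector field `T` that is `δ`-close to `∂₀` on the band, at every band point `z` and
every time there is a multiplier `μ`, `|μ| ≤ ε₁⁻¹`, with
`ε₁²‖w‖² ≤ μ (Φ^* g)_z(w,w) − Hess r_z(w,w) + ε₁⁻² ((Φ^* g)_z(T z, w)² + dr_z(w)²)` for all `w` —
a band point `z` at time `t = z⁰` is translated to the slice (`z = z' + t ∂₀`), the components are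
translated along (`y ↦ (Φ^* g)(y + t ∂₀)`), and Kerr is stationary, so the `1`-jets at `z'` of
the translated components relative to `g_ℓ` are those at `z`, bounded by the sup norm, the
translated conditioning form at `z'` with `e' = T z` is the one at `z`, while the Hessian is
natural under translations. [cite: IonescuKlainerman2013, Lemma 2.11] -/
theorem stub_kerrConditionalMultiplierU_of_margin :
    ∀ (K : Set (ℝ × ℝ)) (r_lo r_e : ℝ × ℝ → ℝ) (m : ℝ), IsCompact K →
      (∀ ℓ ∈ K, 0 < ℓ.1 ∧ |ℓ.2| < ℓ.1) → ContinuousOn r_lo K → ContinuousOn r_e K →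
      (∀ ℓ ∈ K, Kerr.rPlus ℓ.1 ℓ.2 < r_lo ℓ) → 0 < m →
      (∀ ℓ ∈ K, ∀ (z w : E4), r_lo ℓ ≤ Kerr.radius ℓ.2 z → Kerr.radius ℓ.2 z ≤ r_e ℓ →
        Kerr.bilin ℓ.1 ℓ.2 z w w = 0 → fderiv ℝ (Kerr.radius ℓ.2) z w = 0 →
        Kerr.bilin ℓ.1 ℓ.2 z (E4.basisVector 0) w = 0 →
        hessAt (Kerr.bilin ℓ.1 ℓ.2) (Kerr.radius ℓ.2) z w w ≤ -m * ‖w‖ ^ 2) →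
      ∃ (δ ε₁ : ℝ), 0 < δ ∧ 0 < ε₁ ∧ ∀ ℓ ∈ K,
      ∀ (𝓢 : Spacetime.{0} 4) (Φ : E4 → 𝓢.carrier) (T : E4 → E4),
        ContMDiffOn 𝓘(ℝ, E4) (𝓡 4) ∞ Φ {z | ℓ.1 < Kerr.radius ℓ.2 z} →
        Topology.IsOpenEmbedding ({z : E4 | ℓ.1 < Kerr.radius ℓ.2 z}.restrict Φ) →
        supCkENorm {z | ℓ.1 < Kerr.radius ℓ.2 z ∧ r_lo ℓ ≤ Kerr.radius ℓ.2 z ∧ Kerr.radius ℓ.2 z ≤ r_e ℓ} 2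
            (fun z => 𝓢.metricInCoords Φ z - Kerr.bilin ℓ.1 ℓ.2 z) ≤ ENNReal.ofReal δ →
        (∀ z : E4, r_lo ℓ ≤ Kerr.radius ℓ.2 z → Kerr.radius ℓ.2 z ≤ r_e ℓ →
          ‖T z - E4.basisVector 0‖ ≤ δ) →
        ∀ z : E4, r_lo ℓ ≤ Kerr.radius ℓ.2 z → Kerr.radius ℓ.2 z ≤ r_e ℓ →
          ∃ μ : ℝ, |μ| ≤ ε₁⁻¹ ∧ ∀ w : E4,
            ε₁ ^ 2 * ‖w‖ ^ 2 ≤ μ * 𝓢.metricInCoords Φ z w w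
              - hessAt (𝓢.metricInCoords Φ) (Kerr.radius ℓ.2) z w w
              + ε₁⁻¹ ^ 2 * ((𝓢.metricInCoords Φ z (T z) w) ^ 2
                + (fderiv ℝ (Kerr.radius ℓ.2) z w) ^ 2) := by
  intro K r_lo r_e m hK hsub hloc hec hlo hm hmargin
  -- the radius is positive on the bands: `r ≥ r_lo ℓ > r₊(ℓ) ≥ ℓ.1 > 0`
  have hMlo : ∀ ℓ ∈ K, ℓ.1 < r_lo ℓ := fun ℓ hℓ ↦
    (le_add_of_nonneg_right (Real.sqrt_nonneg _) : ℓ.1 ≤ Kerr.rPlus ℓ.1 ℓ.2).trans_lt (hlo ℓ hℓ)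
  have hlo0 : ∀ ℓ ∈ K, 0 < r_lo ℓ := fun ℓ hℓ ↦ (hsub ℓ hℓ).1.trans (hMlo ℓ hℓ)
  -- the compact labelled time slice of the bands, inside the open set `{r > 0}`
  set S : Set ((ℝ × ℝ) × E4) := {q | q.1 ∈ K ∧ q.2 0 = 0 ∧ r_lo q.1 ≤ Kerr.radius q.1.2 q.2 ∧
    Kerr.radius q.1.2 q.2 ≤ r_e q.1} with hSdef
  have hS : IsCompact S := stub_kerrEscapeFieldsContinuousU_isCompact_slice hK hloc hec
  have hSpos : ∀ q ∈ S, 0 < Kerr.radius q.1.2 q.2 := fun q hq ↦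
    (hlo0 q.1 hq.1).trans_le hq.2.2.1
  -- joint smoothness of the Kerr–Schild family and of the radius in the labelled point on `{r > 0}`
  have hU : ∃ U : Set ((ℝ × ℝ) × E4), IsOpen U ∧ S ⊆ U ∧
      ContDiffOn ℝ ∞ (fun q : (ℝ × ℝ) × E4 => Kerr.bilin q.1.1 q.1.2 q.2) U ∧
      ContDiffOn ℝ ∞ (fun q : (ℝ × ℝ) × E4 => Kerr.radius q.1.2 q.2) U := by
    refine ⟨{q | 0 < Kerr.radius q.1.2 q.2},
      isOpen_lt continuous_const stub_kerrBandHigherRegularityU_continuous_radius, hSpos,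
      fun q hq ↦ ?_, fun q hq ↦ ?_⟩
    · exact ((Kerr.contDiffAt_bilin₃ (n := ∞) (q := (q.1.1, q.1.2, q.2)) hq).comp q
        (contDiffAt_fst.fst.prodMk (contDiffAt_fst.snd.prodMk contDiffAt_snd))).contDiffWithinAt
    · exact ((Kerr.contDiffAt_radius₂ (n := ∞) (p := (q.1.2, q.2)) hq).comp q
        (contDiffAt_fst.snd.prodMk contDiffAt_snd)).contDiffWithinAt
  have hinv : ∀ q ∈ S, (Kerr.bilin q.1.1 q.1.2 q.2).IsInvertible := fun q hq ↦
    isInvertible_of_nondegenerate fun v hv ↦ Kerr.bilin_nondegenerate _ _ (hSpos q hq) v hv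
  -- the zero-energy margin (hypothesis) on the labelled slice, conditioning vector `e = ∂₀`
  have hmarginS : ∀ q ∈ S, ∀ w : E4, Kerr.bilin q.1.1 q.1.2 q.2 w w = 0 →
      fderiv ℝ (Kerr.radius q.1.2) q.2 w = 0 →
      Kerr.bilin q.1.1 q.1.2 q.2 (E4.basisVector 0) w = 0 →
      hessAt (Kerr.bilin q.1.1 q.1.2) (Kerr.radius q.1.2) q.2 w w ≤ -m * ‖w‖ ^ 2 :=
    fun q hq w hnull hdr horth ↦ hmargin q.1 hq.1 q.2 w hq.2.2.1 hq.2.2.2 hnull hdr horth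
  obtain ⟨δ, ε₁, hδ, hε₁, hstab⟩ :=
    stub_multiplierFormStableParam (fun p : ℝ × ℝ => Kerr.bilin p.1 p.2)
      (fun p : ℝ × ℝ => Kerr.radius p.2) (E4.basisVector 0) S m hS hm hU hinv hmarginS
  refine ⟨δ, ε₁, hδ, hε₁, ?_⟩
  intro ℓ hℓ 𝓢 Φ T hΦ _ hsup hT z hzlo hze
  -- smoothness of the pulled-back components on the open exterior region, and of `g_ℓ`
  have hO : IsOpen {z : E4 | ℓ.1 < Kerr.radius ℓ.2 z} :=
    isOpen_lt continuous_const (Kerr.continuous_radius ℓ.2)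
  have hz : z ∈ {z : E4 | ℓ.1 < Kerr.radius ℓ.2 z} := (hMlo ℓ hℓ).trans_le hzlo
  have hGdiff : DifferentiableAt ℝ (𝓢.metricInCoords Φ) z :=
    (((𝓢.contDiffOn_metricInCoords hO hΦ) z hz).contDiffAt (hO.mem_nhds hz)).differentiableAt
      (by simp)
  have hzpos : 0 < Kerr.radius ℓ.2 z := (hlo0 ℓ hℓ).trans_le hzlo
  have hKdiff : DifferentiableAt ℝ (Kerr.bilin ℓ.1 ℓ.2) z :=
    (Kerr.contDiffAt_bilin ℓ.1 ℓ.2 hzpos (n := 1)).differentiableAt one_ne_zero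
  -- pointwise `C¹`-closeness at `z` from the `C²` sup norm over the band
  have hzK : z ∈ {z : E4 | ℓ.1 < Kerr.radius ℓ.2 z ∧
      r_lo ℓ ≤ Kerr.radius ℓ.2 z ∧ Kerr.radius ℓ.2 z ≤ r_e ℓ} := ⟨hz, hzlo, hze⟩
  have hjet : ∀ k ≤ 2,
      ‖iteratedFDeriv ℝ k (fun z ↦ 𝓢.metricInCoords Φ z - Kerr.bilin ℓ.1 ℓ.2 z) z‖ ≤ δ := by
    intro k hk
    have h := (enorm_iteratedFDeriv_le_supCkENorm hk hzK
      (fun z ↦ 𝓢.metricInCoords Φ z - Kerr.bilin ℓ.1 ℓ.2 z)).trans hsup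
    rwa [← ofReal_norm, ENNReal.ofReal_le_ofReal_iff hδ.le] at h
  have hd0 : ‖𝓢.metricInCoords Φ z - Kerr.bilin ℓ.1 ℓ.2 z‖ ≤ δ := by
    have h := hjet 0 (by norm_num)
    rwa [norm_iteratedFDeriv_zero] at h
  have hd1 : ‖fderiv ℝ (𝓢.metricInCoords Φ) z - fderiv ℝ (Kerr.bilin ℓ.1 ℓ.2) z‖ ≤ δ := by
    have h := hjet 1 (by norm_num)
    rwa [norm_iteratedFDeriv_one, fderiv_fun_sub hGdiff hKdiff] at h
  -- translate `z` to the time slice: `z = z' + t ∂₀`, `t = z⁰`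
  obtain ⟨t, ht⟩ : ∃ t : ℝ, z 0 = t := ⟨_, rfl⟩
  obtain ⟨z', hz'z⟩ : ∃ z' : E4, z' + t • E4.basisVector 0 = z :=
    ⟨z - t • E4.basisVector 0, sub_add_cancel z _⟩
  have hz'0 : z' 0 = 0 := by
    have h : (z' + t • E4.basisVector 0) 0 = z 0 := by rw [hz'z]
    rw [ht] at h
    simpa [E4.basisVector] using h
  -- stationarity of Kerr: the radius, the components and their first derivatives agree
  have hradfun : (fun y : E4 ↦ Kerr.radius ℓ.2 (y + t • E4.basisVector 0)) = Kerr.radius ℓ.2 :=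
    funext fun y ↦ Kerr.radius_add_time_smul_basisVector ℓ.2 y t
  have hbilfun :
      (fun y : E4 ↦ Kerr.bilin ℓ.1 ℓ.2 (y + t • E4.basisVector 0)) = Kerr.bilin ℓ.1 ℓ.2 :=
    funext fun y ↦ Kerr.bilin_add_smul_basisVector_zero ℓ.1 ℓ.2 y t
  have hrad' : Kerr.radius ℓ.2 z' = Kerr.radius ℓ.2 z := by
    rw [← hz'z, Kerr.radius_add_time_smul_basisVector]
  have hbil' : Kerr.bilin ℓ.1 ℓ.2 z' = Kerr.bilin ℓ.1 ℓ.2 z := by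
    rw [← hz'z, Kerr.bilin_add_smul_basisVector_zero]
  have hfdrad' : fderiv ℝ (Kerr.radius ℓ.2) z' = fderiv ℝ (Kerr.radius ℓ.2) z := by
    rw [← hz'z, ← fderiv_comp_add_right (t • E4.basisVector 0)]
    exact (congrArg (fun g : E4 → ℝ ↦ fderiv ℝ g z') hradfun).symm
  have hfdbil' : fderiv ℝ (Kerr.bilin ℓ.1 ℓ.2) z' = fderiv ℝ (Kerr.bilin ℓ.1 ℓ.2) z := by
    rw [← hz'z, ← fderiv_comp_add_right (t • E4.basisVector 0)]
    exact (congrArg (fun g : E4 → E4 →L[ℝ] E4 →L[ℝ] ℝ ↦ fderiv ℝ g z') hbilfun).symm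
  have hz'S : (ℓ, z') ∈ S := by
    rw [hSdef]
    exact ⟨hℓ, hz'0, hzlo.trans_eq hrad'.symm, hrad'.trans_le hze⟩
  -- the translated components `y ↦ (Φ^* g)(y + t ∂₀)` and the naturality of the Hessian
  have hGt1 : fderiv ℝ (fun y ↦ 𝓢.metricInCoords Φ (y + t • E4.basisVector 0)) z' =
      fderiv ℝ (𝓢.metricInCoords Φ) z := by
    rw [fderiv_comp_add_right, hz'z]
  have hH : hessAt (fun y ↦ 𝓢.metricInCoords Φ (y + t • E4.basisVector 0)) (Kerr.radius ℓ.2) z' =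
      hessAt (𝓢.metricInCoords Φ) (Kerr.radius ℓ.2) z := by
    have h := kerrCylindersBendInward_hessAt_comp_add_right (𝓢.metricInCoords Φ)
      (Kerr.radius ℓ.2) (t • E4.basisVector 0) z'
    rw [hradfun, hz'z] at h
    exact h
  -- (UP-1) at `q = (ℓ, z')`, `G =` the translated components, `e' = T z`
  obtain ⟨μ, hμ, hall⟩ := hstab (ℓ, z') hz'S
    (fun y ↦ 𝓢.metricInCoords Φ (y + t • E4.basisVector 0)) (T z)
    (by
      show ‖𝓢.metricInCoords Φ (z' + t • E4.basisVector 0) - Kerr.bilin ℓ.1 ℓ.2 z'‖ ≤ δ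
      rw [hz'z, hbil']
      exact hd0)
    (by
      show ‖fderiv ℝ (fun y ↦ 𝓢.metricInCoords Φ (y + t • E4.basisVector 0)) z' -
        fderiv ℝ (Kerr.bilin ℓ.1 ℓ.2) z'‖ ≤ δ
      rw [hGt1, hfdbil']
      exact hd1)
    (hT z hzlo hze)
  refine ⟨μ, hμ, fun w ↦ ?_⟩
  -- the multiplier form at `z'` for the translated data is the one at `z`
  have key : ε₁ ^ 2 * ‖w‖ ^ 2 ≤ μ * 𝓢.metricInCoords Φ (z' + t • E4.basisVector 0) w w
      - hessAt (fun y ↦ 𝓢.metricInCoords Φ (y + t • E4.basisVector 0)) (Kerr.radius ℓ.2) z' w w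
      + ε₁⁻¹ ^ 2 * ((𝓢.metricInCoords Φ (z' + t • E4.basisVector 0) (T z) w) ^ 2
        + (fderiv ℝ (Kerr.radius ℓ.2) z' w) ^ 2) := hall w
  rw [hH, hfdrad', hz'z] at key
  exact key

end Summit.FinalStateConjecture.FinalStateConjecture.Theorems

end
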